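import Summits.BirchSwinnertonDyer.BirchSwinnertonDyer.Theorems.SmallImageMuTransferMuTransferX9CentralScalarOdd
import Literature.NumberTheory.GaloisRepresentations.ContinuousH1TrivialRestriction
import Literature.NumberTheory.EllipticCurves.IwasawaTwistModPCentralHomothety
import HarnessLib

/-!
# Step 2 of the `μ`-transfer core (`stub_coreX9`, crux 19276 `MuTransferX9`): the coset
# representative for Chebotarev — prescribed joint value AND prescribed `κ`-value / exact depth

Cell `b2b-bsdres` (X9 prover lineage, GEN 43) serving the K6 route `SmallImageMuTransfer` of cell
`bsd-smallim`. HONEST FRAMING: the cell deletes COMBINATION-SHAPED residual classes of the rank-≤1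
BSD formula from PUBLISHED theorems only and TYPES the construction-shaped remainder; this is not
"finishing BSD". Class X9 (good ordinary `p ≥ 5`, `ρ̄_{E,p}` irreducible and NOT surjective) stays
TYPED at class level. This file is a `--supports` helper toward the registered stub `stub_coreX9` of
the deciding crux stmt-BirchSwinnertonDyer-19276; it books nothing and closes nothing. Theorems only
(no definition, no named fact).

## What is proved (HOME/koly/MU-TRANSFER-PROOF.md §5 STEP 2, referee PASS v4–v11)

STEP 2 of Theorem A needs a prime `q` whose Frobenius in the governing field
`L' = L_M(μ_{p^{m₀+1}})` is a PRESCRIBED element `(1_{L₀}; (x, x^*), t)` with `t ≠ 0`: trivial on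
`L₀` (so `q` is `E`-split of depth `≥ e = pⁿ`), with prescribed joint value `(x, x^*) ∈ M =
im(h, h^*)` of the two restricted test cocycles, and non-trivial on `μ_{p^{m₀+1}}` (depth EXACTLY `e`).
Chebotarev (tree: `exists_isArithFrobAt_mul_inv_mem_not_mem`, k6-ty) turns an ELEMENT `g ∈ Γ_ℚ` with
these three properties into infinitely many such primes; the memo obtains the element from
"`Gal(L'/L₀) = M × ℤ/p`" ([Gou] + the central scalar of (F2); kernel form
`LevelE.eq_top_of_scalar_stable`, k6-c2). THIS FILE PRODUCES THE ELEMENT, on the genuine objects and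
in the subgroup currency of the Step-1 files (`contOneCocycles.jointValueSubgroup`, k6-c2 p437287;
joint kernel `N_J(κ) ⊓ N_{J'}(κ')`, k6-c2 p440695/p441592):

* §1 (generic cocycle algebra, any `TopRep`s `X`, `Y` of a group `G`): for `H ⊴ G` acting trivially
  on `X` and `Y`, a homomorphism `χ` on `G` and `z ∈ G` central under `χ` with `m • (z•v − v) = v` on
  `X` and `Y`, the commutator `c = z τ z⁻¹ τ⁻¹` of `τ ∈ H` lies in `H ∩ ker χ` with joint value
  `(z − 1)·(φ τ, ψ τ)`, so `c^m` realises `(φ τ, ψ τ)` INSIDE `ker χ`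
  (`exists_mem_map_eq_one_apply_eq`); hence every joint value `w ∈ (φ, ψ)(H)` is `(φ σ, ψ σ)` for
  some `σ ∈ H` with `χ σ = χ σ₁`, `σ₁ ∈ H` PRESCRIBED (`exists_mem_map_eq_apply_eq`). This is the
  element form of `eq_top_of_scalar_stable` («`(λ − 1)(m, 0) ∈ L`»), without naming `L'`.
* §2 (any base field `F`): the scalar hypothesis on `𝒯_J(E) = W.modPTwist p κ J` for `σ₀ ∈ ker κ`
  acting on `E[p]` as `a ≠ 1` (`m = (a − 1)⁻¹ mod p`; GEN 42's `modPTwist_eq_smul_of_mem_kerSubgroup`);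
  the inclusions `N_J(κ) ≤ ker ρ̄_{E,p}` (`J ≥ 1`: every element of the joint kernel is `E`-split) and
  `G_{L₀} := ker ρ̄_{E,p} ⊓ Gal(F̄/F_n) ≤ N_J(κ)` (`J ≤ pⁿ`: (F8) "`G_{L₀}` acts trivially on `𝒯_e`").
* §3 (`E/ℚ`, `p` odd, `E[p]` irreducible, `ρ̄_{E,p}` not onto; `κ` any `ℤ_p`-extension, `κ'` with
  the same kernel, e.g. the dual deformation `κ.invTwist`): **`exists_mem_apply_eq_and_apply_eq_of_ne_two`**
  — for any normal `H` acting trivially on `𝒯_J(E, κ)`, `𝒯_{J'}(E, κ')`, every `σ₁ ∈ H` and every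
  joint value `w`: `∃ σ ∈ H, κ σ = κ σ₁ ∧ (φ σ, ψ σ) = w` (with `z = σ₀` the central scalar INSIDE
  `ker κ` of GEN 42, `exists_mem_kerSubgroup_smul_eq_of_ne_two`, and `χ = κ`); and
  **`exists_mem_apply_eq_and_depth_of_ne_two`** — if `G_{L₀} ≤ H ≤ ker ρ̄`, every joint value is
  realised by `σ ∈ H` with `ρ̄(σ) = 1`, `σ ∈ Gal(ℚ̄/ℚ_n)`, `σ ∉ Gal(ℚ̄/ℚ_{n+1})` (depth from GEN 42's
  element of `G_{L₀} ∖ Gal(ℚ̄/ℚ_{n+1})`, "`μ_{p^{m₀+1}} ⊄ L₀`") — the `g` of Chebotarev, in the depth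
  spelling `g ∈ Γ_n ∖ Γ_{n+1}` of koly's `twistExponent_eq_prime_pow_mul_of_depth` /
  `exists_isAbsArithFrob_split_of_isArithFrobAt`.

The sequel `…X9StepTwoElementKernels.lean` instantiates §3 on the two subgroups of record (k6-c2's
joint kernel `N_J(κ) ⊓ N_{J'}(κ⁻¹)` and `G_{L₀}`) and on `ClassX9`.

PARTITION (D-0054): X9 (A4) · X10∧¬Surj (A5) at `p = 3` — hypothesis-discharging helper toward
`stub_coreX9`; closes NONE.

References: J.-P. Serre, Invent. Math. 15 (1972) §2.4 Prop. 15, §2.6 [Serre1972]; C.-H. Sah,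
*Automorphisms of finite groups*, J. Algebra 10 (1968) Prop. 2.7 (b) [Sah1968]; J.-P. Serre, *Local
Fields*, VII §5 [SerreLocalFields1979]; L. Washington, *Cyclotomic Fields*, §13.1–§13.2
[Washington1997]; HOME/koly/MU-TRANSFER-PROOF.md (F2), (F8), §5 STEP 2; HOME
plan/k6/lines/MuTransferX9_CORE-PLAN_k6c2.md S2.3/S4.1.
-/

-- the summit and its single problem are both named `BirchSwinnertonDyer` (registry layout D-0017)
set_option linter.dupNamespace false

set_option autoImplicit false

noncomputable section

open Field WeierstrassCurve Literature.NumberTheory.EllipticCurves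
  Literature.NumberTheory.GaloisRepresentations Function

namespace Summit.BirchSwinnertonDyer.BirchSwinnertonDyer.Rank1Residual

/-! ### §1 Generic cocycle algebra: joint values with prescribed character value -/

namespace JointValue

universe u v

variable {R : Type u} [Ring R] [TopologicalSpace R]
variable {G : Type v} [Group G] [TopologicalSpace G]
variable {X Y : TopRep.{v} R G}

/-- `φ(τ^m) = m • φ(τ)` for `τ` acting trivially. [cite: SerreLocalFields1979, VII §5] -/
theorem apply_pow_of_fixed (φ : contOneCocycles X) {τ : G} (hτ : ∀ x : X, X.ρ τ x = x) (m : ℕ) :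
    φ.1 (τ ^ m) = m • φ.1 τ := by
  induction m with
  | zero => rw [pow_zero, contOneCocycles.apply_one, zero_nsmul]
  | succ m ih => rw [pow_succ', contOneCocycles.apply_mul_of_fixed φ hτ, ih, succ_nsmul']

/-- The commutator `z τ z⁻¹ τ⁻¹` of any `z ∈ G` with `τ ∈ H` (`H` normal, acting trivially) lies in
`H` and has `φ`-value `z•φ(τ) − φ(τ)`. [cite: SerreLocalFields1979, VII §5 Prop. 3] -/
theorem apply_comm_of_fixed (φ : contOneCocycles X) (H : Subgroup G) [H.Normal]
    (hX : ∀ τ ∈ H, ∀ x : X, X.ρ τ x = x) (z : G) {τ : G} (hτ : τ ∈ H) :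
    z * τ * z⁻¹ * τ⁻¹ ∈ H ∧ φ.1 (z * τ * z⁻¹ * τ⁻¹) = X.ρ z (φ.1 τ) - φ.1 τ := by
  have hc : z * τ * z⁻¹ ∈ H := Subgroup.Normal.conj_mem inferInstance τ hτ z
  refine ⟨H.mul_mem hc (H.inv_mem hτ), ?_⟩
  rw [contOneCocycles.apply_mul_of_fixed φ (hX _ hc), contOneCocycles.apply_conj_of_fixed φ (hX τ hτ),
    contOneCocycles.apply_inv_of_fixed φ (hX τ hτ), sub_eq_add_neg]

omit [TopologicalSpace G] in
/-- A homomorphism under which `z` is central kills the commutator `z τ z⁻¹ τ⁻¹`. [folklore] -/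
theorem map_comm_eq_one {B : Type*} [Group B] {Fχ : Type*} [FunLike Fχ G B]
    [MonoidHomClass Fχ G B] (χ : Fχ) {z : G} (hz : ∀ g : G, χ z * χ g = χ g * χ z) (τ : G) :
    χ (z * τ * z⁻¹ * τ⁻¹) = 1 := by
  rw [map_mul, map_mul, map_mul, map_inv, map_inv, hz τ, mul_inv_cancel_right, mul_inv_cancel]

/-- **Every joint value is realised inside `ker χ`.** Let `H ⊴ G` act trivially on `X` and `Y`, let
`z ∈ G` be central under a homomorphism `χ` and act on `X` and `Y` so that `m • (z•v − v) = v` (e.g.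
by a scalar `a` with `m(a − 1) ≡ 1`). Then every joint value `w = (φ τ, ψ τ)`, `τ ∈ H`, is the joint
value of some `ν ∈ H` with `χ ν = 1` (namely `ν = (z τ z⁻¹ τ⁻¹)^m`).
[cite: SerreLocalFields1979, VII §5 Prop. 3] [cite: Sah1968, Prop. 2.7 (b)] -/
theorem exists_mem_map_eq_one_apply_eq (φ : contOneCocycles X) (ψ : contOneCocycles Y)
    (H : Subgroup G) [H.Normal] (hX : ∀ τ ∈ H, ∀ x : X, X.ρ τ x = x)
    (hY : ∀ τ ∈ H, ∀ y : Y, Y.ρ τ y = y) {B : Type*} [Group B] {Fχ : Type*} [FunLike Fχ G B]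
    [MonoidHomClass Fχ G B] (χ : Fχ) {z : G} (hz : ∀ g : G, χ z * χ g = χ g * χ z) {m : ℕ}
    (hzX : ∀ x : X, m • (X.ρ z x - x) = x) (hzY : ∀ y : Y, m • (Y.ρ z y - y) = y) {w : X × Y}
    (hw : w ∈ contOneCocycles.jointValueSubgroup φ ψ H hX hY) :
    ∃ ν ∈ H, χ ν = 1 ∧ φ.1 ν = w.1 ∧ ψ.1 ν = w.2 := by
  obtain ⟨τ, hτ, rfl⟩ := hw
  obtain ⟨hc, hφc⟩ := apply_comm_of_fixed φ H hX z hτ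
  obtain ⟨-, hψc⟩ := apply_comm_of_fixed ψ H hY z hτ
  refine ⟨(z * τ * z⁻¹ * τ⁻¹) ^ m, H.pow_mem hc m, ?_, ?_, ?_⟩
  · rw [map_pow, map_comm_eq_one χ hz τ, one_pow]
  · rw [apply_pow_of_fixed φ (hX _ hc), hφc, hzX]
  · rw [apply_pow_of_fixed ψ (hY _ hc), hψc, hzY]

/-- **Joint values with prescribed character value** (MU-TRANSFER-PROOF §5 STEP 2, the element form
of «`Gal(L'/L₀) = M × ℤ/p`»). Under the hypotheses of `exists_mem_map_eq_one_apply_eq`: for every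
`σ₁ ∈ H` and every joint value `w ∈ (φ, ψ)(H)` there is `σ ∈ H` with joint value `w` AND
`χ σ = χ σ₁`. [cite: SerreLocalFields1979, VII §5 Prop. 3] [cite: Sah1968, Prop. 2.7 (b)] -/
theorem exists_mem_map_eq_apply_eq (φ : contOneCocycles X) (ψ : contOneCocycles Y)
    (H : Subgroup G) [H.Normal] (hX : ∀ τ ∈ H, ∀ x : X, X.ρ τ x = x)
    (hY : ∀ τ ∈ H, ∀ y : Y, Y.ρ τ y = y) {B : Type*} [Group B] {Fχ : Type*} [FunLike Fχ G B]
    [MonoidHomClass Fχ G B] (χ : Fχ) {z : G} (hz : ∀ g : G, χ z * χ g = χ g * χ z) {m : ℕ}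
    (hzX : ∀ x : X, m • (X.ρ z x - x) = x) (hzY : ∀ y : Y, m • (Y.ρ z y - y) = y) {σ₁ : G}
    (hσ₁ : σ₁ ∈ H) {w : X × Y} (hw : w ∈ contOneCocycles.jointValueSubgroup φ ψ H hX hY) :
    ∃ σ ∈ H, χ σ = χ σ₁ ∧ φ.1 σ = w.1 ∧ ψ.1 σ = w.2 := by
  have hw₁ : ((φ.1 σ₁, ψ.1 σ₁) : X × Y) ∈ contOneCocycles.jointValueSubgroup φ ψ H hX hY :=
    ⟨σ₁, hσ₁, rfl⟩
  obtain ⟨ν, hν, hχν, hφν, hψν⟩ := exists_mem_map_eq_one_apply_eq φ ψ H hX hY χ hz hzX hzY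
    (AddSubgroup.sub_mem _ hw hw₁)
  refine ⟨ν * σ₁, H.mul_mem hν hσ₁, ?_, ?_, ?_⟩
  · rw [map_mul, hχν, one_mul]
  · rw [contOneCocycles.apply_mul_of_fixed φ (hX ν hν), hφν, Prod.fst_sub, sub_add_cancel]
  · rw [contOneCocycles.apply_mul_of_fixed ψ (hY ν hν), hψν, Prod.snd_sub, sub_add_cancel]

end JointValue

/-! ### §2 Any base field: the scalar hypothesis on `𝒯_J(E)` and the kernels around `G_{L₀}` -/

section AnyField

universe u

variable {F : Type u} [Field F] (W : WeierstrassCurve F) (p : ℕ) [Fact p.Prime]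
  (κ : ZpExtension F p)

/-- On the `𝔽_p`-vector space `𝒯_J(E)`: `(a − 1)⁻¹ • (a•x − x) = x` for `a ∈ 𝔽_p`, `a ≠ 1` (the
integer `m = ((a−1)⁻¹).val` of §1 for a homothety `a`). [cite: Serre1972, §2.6] -/
theorem val_inv_sub_one_nsmul_sub_eq (J : ℕ) {a : ZMod p} (ha : a ≠ 1)
    (x : Fin J → geomTorsion W p) : ((a - 1)⁻¹ : ZMod p).val • (a.val • x - x) = x := by
  letI : Module (ZMod p) (geomTorsion W p) := AddSubgroup.torsionBy.zmodModule
  rw [← Nat.cast_smul_eq_nsmul (ZMod p) a.val x, ZMod.natCast_zmod_val,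
    ← Nat.cast_smul_eq_nsmul (ZMod p) ((a - 1)⁻¹ : ZMod p).val, ZMod.natCast_zmod_val,
    show a • x - x = (a - 1) • x by rw [sub_smul, one_smul], smul_smul,
    inv_mul_cancel₀ (sub_ne_zero.mpr ha), one_smul]

/-- **The scalar hypothesis `hzX` of §1 on the genuine `𝒯_J(E)`**: for `σ₀ ∈ ker κ` acting on
`E[p]` as `a ≠ 1`, `((a−1)⁻¹).val • (σ₀•x − x) = x` on `W.modPTwist p κ J` (at every `J`; for `κ`
and for every `ℤ_p`-extension with the same kernel, e.g. `κ.invTwist`).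
[cite: Serre1972, §2.6] [cite: Washington1997, §13.1–§13.2] -/
theorem val_inv_sub_one_nsmul_rho_sub_eq (J : ℕ) {σ₀ : absoluteGaloisGroup F} {a : ZMod p}
    (ha : a ≠ 1) (hσ₀ : ∀ P : geomTorsion W p, σ₀ • P = a.val • P) (hκ : σ₀ ∈ κ.kerSubgroup)
    (x : (W.modPTwist p κ J).toTopRep) :
    ((a - 1)⁻¹ : ZMod p).val • ((W.modPTwist p κ J).toTopRep.ρ σ₀ x - x) = x := by
  have h : (W.modPTwist p κ J).toTopRep.ρ σ₀ x = a.val • x :=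
    modPTwist_eq_smul_of_mem_kerSubgroup p W κ J hσ₀ hκ x
  rw [h]
  exact val_inv_sub_one_nsmul_sub_eq W p J ha x

omit [Fact p.Prime] in
/-- `ρ̄_{E,p}(σ) = 1` from `σ • P = P` for all `P ∈ E[p]`. [folklore] -/
theorem galoisRepTorsion_eq_one_of_forall_smul_eq {σ : absoluteGaloisGroup F}
    (h : ∀ P : geomTorsion W p, σ • P = P) : galoisRepTorsion W p σ = 1 :=
  Multiplicative.toAdd.injective (AddEquiv.ext fun P => by rw [galoisRepTorsion_apply]; exact h P)

omit [Fact p.Prime] in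
/-- `σ • P = P` for all `P ∈ E[p]` from `ρ̄_{E,p}(σ) = 1`. [folklore] -/
theorem forall_smul_eq_of_galoisRepTorsion_eq_one {σ : absoluteGaloisGroup F}
    (h : galoisRepTorsion W p σ = 1) (P : geomTorsion W p) : σ • P = P := by
  rw [← galoisRepTorsion_apply, h]
  rfl

/-- **`N_J(κ) := ker(Γ_F → Aut 𝒯_J(E)) ≤ ker ρ̄_{E,p}` for `J ≥ 1`** (read the constant coefficient:
`((1+S)^e y)_0 = y_0`). So every element of k6-c2's joint kernel is `E`-split.
[cite: Washington1997, §13.1–§13.2] -/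
theorem ker_twistModPRepresentation_le_ker {J : ℕ} (hJ : 0 < J) :
    (κ.twistModPRepresentation (W.torsionGaloisModule (p : ℤ))
        (fun P : geomTorsion W (p : ℤ) => AddSubgroup.torsionBy.nsmul P) J).ker ≤
      (galoisRepTorsion W p).ker := by
  intro σ hσ
  rw [MonoidHom.mem_ker] at hσ ⊢
  refine galoisRepTorsion_eq_one_of_forall_smul_eq W p fun P => ?_
  have h0 := congr_fun (LinearMap.congr_fun hσ (fun _ : Fin J => P)) ⟨0, hJ⟩
  rw [Module.End.one_apply, ZpExtension.twistModPRepresentation_apply,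
    ZpExtension.unipotentPow_apply_zero hJ] at h0
  exact h0

/-- `Gal(F̄/F_n)` acts on `𝒯_J(E)` through `E[p]` alone as soon as `J ≤ p^n` (no `n ≤ J` needed:
for `J < n` pass to the layer `J`). [cite: Washington1997, §13.1–§13.2] -/
theorem modPTwist_apply_of_mem_layerSubgroup_of_le {J n : ℕ} (hJ : J ≤ p ^ n)
    {σ : absoluteGaloisGroup F} (hσ : σ ∈ κ.layerSubgroup n) (x : Fin J → geomTorsion W p) :
    W.modPTwist p κ J σ x = fun i => σ • x i := by
  rcases le_total n J with hnJ | hJn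
  · exact modPTwist_apply_of_mem_layerSubgroup W p κ J hnJ hJ hσ x
  · exact modPTwist_apply_of_mem_layerSubgroup W p κ J le_rfl
      (Nat.lt_pow_self (Fact.out : p.Prime).one_lt).le (κ.layerSubgroup_antitone hJn hσ) x

/-- **`G_{L₀} = ker ρ̄_{E,p} ⊓ Gal(F̄/F_n) ≤ N_J(κ)` for `J ≤ p^n`** (MU-TRANSFER-PROOF (F8): "`G_{L₀}`
acts TRIVIALLY on `𝒯_e`", `e = p^n`). [cite: Washington1997, §13.1–§13.2] -/
theorem ker_inf_layerSubgroup_le_ker_twistModPRepresentation {J n : ℕ} (hJ : J ≤ p ^ n) :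
    (galoisRepTorsion W p).ker ⊓ κ.layerSubgroup n ≤
      (κ.twistModPRepresentation (W.torsionGaloisModule (p : ℤ))
        (fun P : geomTorsion W (p : ℤ) => AddSubgroup.torsionBy.nsmul P) J).ker := by
  intro σ hσ
  obtain ⟨hρ, hn⟩ := Subgroup.mem_inf.mp hσ
  rw [MonoidHom.mem_ker] at hρ ⊢
  refine LinearMap.ext fun x => ?_
  change W.modPTwist p κ J σ x = x
  rw [modPTwist_apply_of_mem_layerSubgroup_of_le W p κ hJ hn x]
  funext i
  exact forall_smul_eq_of_galoisRepTorsion_eq_one W p hρ (x i)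

/-- Hence `G_{L₀}` acts trivially on `𝒯_J(E)` in the `TopRep` spelling (hypothesis `hX` of the
cocycle lemmas), `J ≤ p^n`. [cite: Washington1997, §13.1–§13.2] -/
theorem toTopRep_ρ_apply_eq_self_of_mem_ker_inf_layerSubgroup {J n : ℕ} (hJ : J ≤ p ^ n)
    {τ : absoluteGaloisGroup F} (hτ : τ ∈ (galoisRepTorsion W p).ker ⊓ κ.layerSubgroup n)
    (x : (W.modPTwist p κ J).toTopRep) : (W.modPTwist p κ J).toTopRep.ρ τ x = x :=
  κ.toTopRep_ρ_apply_eq_self_of_mem_ker (W.torsionGaloisModule (p : ℤ)) _ J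
    (ker_inf_layerSubgroup_le_ker_twistModPRepresentation W p κ hJ hτ) x

/-- `σ` and `σ₁` lie in the same layers `Gal(F̄/F_k)` as soon as `κ σ = κ σ₁`. [cite: Washington1997, §13.1] -/
theorem mem_layerSubgroup_iff_of_apply_eq {σ σ₁ : absoluteGaloisGroup F} (h : κ σ = κ σ₁) (k : ℕ) :
    σ ∈ κ.layerSubgroup k ↔ σ₁ ∈ κ.layerSubgroup k := by
  rw [ZpExtension.mem_layerSubgroup, ZpExtension.mem_layerSubgroup, h]

end AnyField

/-! ### §3 Over `ℚ` at every odd prime, `E[p]` irreducible, `ρ̄_{E,p}` not onto: the Step-2 element -/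

section Rat

variable (W : WeierstrassCurve ℚ) [W.IsElliptic] (p : ℕ) [Fact p.Prime] (κ κ' : ZpExtension ℚ p)

/-- **MU-TRANSFER-PROOF §5 STEP 2, the coset representative with prescribed `κ`-value.** `E/ℚ`,
`p` odd, `E[p]` irreducible, `ρ̄_{E,p}` not onto; `κ` any `ℤ_p`-extension of `ℚ` and `κ'` one with
the same kernel (e.g. `κ' = κ.invTwist`, the dual deformation). Let `H ⊴ Γ_ℚ` act trivially on
`𝒯_J(E, κ)` and `𝒯_{J'}(E, κ')`, `φ`, `ψ` continuous 1-cocycles in these, `M = (φ, ψ)(H)` their joint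
value group. Then for every `σ₁ ∈ H` and every `w ∈ M` there is `σ ∈ H` with `(φ σ, ψ σ) = w` and
`κ σ = κ σ₁`. (§1 with `z = σ₀ ∈ ker κ` the central scalar of GEN 42, acting as `a ≠ 1` on both
twists, `m = (a−1)⁻¹ mod p`, `χ = κ`.) [cite: Serre1972, §2.4 Prop. 15 and §2.6]
[cite: Sah1968, Prop. 2.7 (b)] [cite: Washington1997, §13.1–§13.2] -/
theorem exists_mem_apply_eq_and_apply_eq_of_ne_two (hp2 : p ≠ 2)
    (hirr : W.HasIrreducibleModPGaloisRep p) (hns : ¬ W.HasSurjectiveModNGaloisRep p)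
    (hker : κ'.kerSubgroup = κ.kerSubgroup) (J J' : ℕ)
    (φ : contOneCocycles (W.modPTwist p κ J).toTopRep)
    (ψ : contOneCocycles (W.modPTwist p κ' J').toTopRep)
    (H : Subgroup (absoluteGaloisGroup ℚ)) [H.Normal]
    (hX : ∀ τ ∈ H, ∀ x : (W.modPTwist p κ J).toTopRep, (W.modPTwist p κ J).toTopRep.ρ τ x = x)
    (hY : ∀ τ ∈ H, ∀ y : (W.modPTwist p κ' J').toTopRep, (W.modPTwist p κ' J').toTopRep.ρ τ y = y)
    {σ₁ : absoluteGaloisGroup ℚ} (hσ₁ : σ₁ ∈ H) {w : (W.modPTwist p κ J).toTopRep × (W.modPTwist p κ' J').toTopRep}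
    (hw : w ∈ contOneCocycles.jointValueSubgroup φ ψ H hX hY) :
    ∃ σ ∈ H, κ σ = κ σ₁ ∧ φ.1 σ = w.1 ∧ ψ.1 σ = w.2 := by
  obtain ⟨σ₀, a, ha, hκ, hσ₀⟩ := exists_mem_kerSubgroup_smul_eq_of_ne_two W p κ hp2 hirr hns
  have hκ' : σ₀ ∈ κ'.kerSubgroup := hker ▸ hκ
  exact JointValue.exists_mem_map_eq_apply_eq φ ψ H hX hY κ (fun g => mul_comm _ _)
    (val_inv_sub_one_nsmul_rho_sub_eq W p κ J ha hσ₀ hκ)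
    (val_inv_sub_one_nsmul_rho_sub_eq W p κ' J' ha hσ₀ hκ') hσ₁ hw

/-- **MU-TRANSFER-PROOF §5 STEP 2, the Chebotarev coset representative** («`Frob|_{L'} =
(1_{L₀}; (x, x^*), t)`, `t ≠ 0`», as an element of `Γ_ℚ`). Same setting, with
`G_{L₀} = ker ρ̄_{E,p} ⊓ Gal(ℚ̄/ℚ_n) ≤ H ≤ ker ρ̄_{E,p}`: for every joint value `w ∈ M = (φ, ψ)(H)`
there is `σ ∈ H` with `(φ σ, ψ σ) = w`, `ρ̄_{E,p}(σ) = 1`, `σ ∈ Gal(ℚ̄/ℚ_n)` and `σ ∉ Gal(ℚ̄/ℚ_{n+1})`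
(depth exactly `n`: the `E`-split prime of depth `e_q = p^n` after Chebotarev). The depth comes from
GEN 42's element of `ker ρ̄ ⊓ Gal(ℚ̄/ℚ_n) ∖ Gal(ℚ̄/ℚ_{n+1})` ("`μ_{p^{m₀+1}} ⊄ L₀`").
[cite: Serre1972, §2.4 Prop. 15 and §2.6] [cite: Sah1968, Prop. 2.7 (b)]
[cite: Washington1997, §13.1–§13.2] -/
theorem exists_mem_apply_eq_and_depth_of_ne_two (hp2 : p ≠ 2)
    (hirr : W.HasIrreducibleModPGaloisRep p) (hns : ¬ W.HasSurjectiveModNGaloisRep p)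
    (hker : κ'.kerSubgroup = κ.kerSubgroup) (J J' n : ℕ)
    (φ : contOneCocycles (W.modPTwist p κ J).toTopRep)
    (ψ : contOneCocycles (W.modPTwist p κ' J').toTopRep)
    (H : Subgroup (absoluteGaloisGroup ℚ)) [H.Normal]
    (hX : ∀ τ ∈ H, ∀ x : (W.modPTwist p κ J).toTopRep, (W.modPTwist p κ J).toTopRep.ρ τ x = x)
    (hY : ∀ τ ∈ H, ∀ y : (W.modPTwist p κ' J').toTopRep, (W.modPTwist p κ' J').toTopRep.ρ τ y = y)
    (hH : (galoisRepTorsion W p).ker ⊓ κ.layerSubgroup n ≤ H)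
    (hHker : H ≤ (galoisRepTorsion W p).ker)
    {w : (W.modPTwist p κ J).toTopRep × (W.modPTwist p κ' J').toTopRep}
    (hw : w ∈ contOneCocycles.jointValueSubgroup φ ψ H hX hY) :
    ∃ σ ∈ H, φ.1 σ = w.1 ∧ ψ.1 σ = w.2 ∧ galoisRepTorsion W p σ = 1 ∧
      σ ∈ κ.layerSubgroup n ∧ σ ∉ κ.layerSubgroup (n + 1) := by
  obtain ⟨σ₁, hσ₁, hσ₁'⟩ :=
    exists_mem_ker_inf_layerSubgroup_not_mem_layerSubgroup_succ W p κ hirr hns n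
  obtain ⟨σ, hσ, hκσ, hφ, hψ⟩ := exists_mem_apply_eq_and_apply_eq_of_ne_two W p κ κ' hp2 hirr hns
    hker J J' φ ψ H hX hY (hH hσ₁) hw
  refine ⟨σ, hσ, hφ, hψ, MonoidHom.mem_ker.mp (hHker hσ), ?_, ?_⟩
  · exact (mem_layerSubgroup_iff_of_apply_eq p κ hκσ n).mpr (Subgroup.mem_inf.mp hσ₁).2
  · exact fun h => hσ₁' ((mem_layerSubgroup_iff_of_apply_eq p κ hκσ (n + 1)).mp h)

end Rat

end Summit.BirchSwinnertonDyer.BirchSwinnertonDyer.Rank1Residual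

end
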